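import Summits.CriticalPhenomena.SAWScalingLimit.Theses.SAWThetaPercolation
import Literature.Probability.RandomPlanarGeometry.SLEExistenceFromTraceInputs
import Literature.Probability.RandomPlanarGeometry.RohdeSchrammCor35Proofs

/-!
# Birth skeleton for crux `ThetaWindowLimit` (stmt-CriticalPhenomena-17996),
# route `SAWThetaPercolation` — line `birth` (`Lines/birth.lean`)

The crux, BY NAME:
`Summit.CriticalPhenomena.SAWScalingLimit.Theses.SAWThetaPercolation.ThetaWindowLimit` — there are a
chordal family `P`, a schedule `ω(δ) → 2` with `ω(δ) < 2` eventually and fugacities `x(δ)` such that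
(i) in every Dobrushin domain some chordal SLE₆ law `μ`, conditioned on the pinch/wall-free event
`E_ε` (`good ε D`), converges in law to `P D` as `ε → 0⁺`, and (ii) for every Dobrushin domain and
every hexagonal endpoint approximation the contact-fugacity interface laws `𝔓_{x(δ),ω(δ)}` on `δℍ`
converge in law to `P D` as `δ → 0⁺`.

## The cut (three named stubs; the composition `ThetaWindowLimit_of` is sorry-free)

The seam is the route's own two-layer plan for this node ("ThetaWindowLimit ⇐ PinchFreeLimitExists →
CornerLimit → UnpinchingWindow", route header, TWO-LAYER PLAN), typed so that the shared witness
`P` of (i) ∧ (ii) is CONSTRUCTED in the composition rather than assumed: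

* `stub_pinchEventPos` (`PinchEventPos`, SLE₆ support lemma, M-sized): for every Dobrushin domain,
  every chordal SLE₆ law `μ` and every `ε > 0`, the pinch/wall-free event has positive mass,
  `μ (E_ε) ≠ 0`. This is exactly the non-degeneracy the refuter's birth attack
  (`Cruxes/ThetaWindowLimit/BirthAttack.lean`, `thetaWindowLimit_of_pinchNull`) showed to be
  load-bearing: under its negation `PinchNull` the crux has the junk witnesses `P := 0`, `xs := 0`.
  On paper: driver uniformly small on `[0, T]` ⇒ thin hull with monotone tip height ⇒ no `ε`-loop and
  no wall contact away from `a`; domain Markov + transience for the final approach to `b`.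
* `stub_pinchFreeLimit` (`PinchFreeLimit`, continuum, open): given that positivity, the conditioned
  laws `μ( · | E_ε)` converge in law, as `ε → 0⁺`, to SOME probability measure `Λ` on `CurveClass ℂ`
  (tightness of the conditioned family + uniqueness of subsequential limits; the existence half of
  the sibling crux `PinchFreeSLE6`, without identifying `Λ`).
* `stub_unpinchingWindow` (`UnpinchingWindow`, lattice → continuum, open — the heart of the crux):
  ONE schedule `ω(δ) → 2⁻`, `x(δ)` such that in every Dobrushin domain, for every chordal SLE₆ law `μ`
  and every probability measure `Λ` that is the `ε → 0⁺` limit in law of `μ( · | E_ε)`, and every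
  hexagonal endpoint approximation, the window laws `𝔓_{x(δ),ω(δ)}` converge in law to `Λ`. Since the
  SLE₆ law of a domain is unique (`IsSLECurve.map_eq_holds`) and limits in law of probability
  measures are unique (`TendstoLaw.unique`), `Λ` is determined by `D`: the stub is part (ii) of the
  crux with `P` pinned to the pinch-free limit family — no strength is hidden; `IsProbabilityMeasure Λ`
  excludes the `xs ≡ 0` junk schedule of the birth attack at stub level.

Composition `ThetaWindowLimit_of`: chordal SLE₆ laws exist in every Dobrushin domain (PROVED in tree:
`exists_isSLECurve_at_of_cor35` + `RohdeSchramm2005_cor35_holds`, Rohde–Schramm Cor. 3.5 ⇒ Thm 5.1,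
Thm 7.1); choose one `μ_D` per domain, let `P D` be the limit given by stubs 1–2 (`Classical.choose`),
and read (ii) off stub 3 at `Λ := P D`.

## Disproof / negatives used
No `Disproof.lean` for this crux (`ledger crux ls stmt-CriticalPhenomena-17996`, 2026-08-17: only
`BirthAttack.lean`). The birth attack's junk-witness analysis is honoured at `stub_pinchEventPos`
(positivity of `E_ε`) and by the `IsProbabilityMeasure Λ` binders of stubs 2–3.
`ledger negatives --problem CriticalPhenomena`: none of the three stubs is an all-`δ` tightness
claim (stmt-0772) or an observable statement (stmt-5420/8312).
-/

noncomputable section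

open MeasureTheory Filter Topology Set
open scoped NNReal ENNReal
open Literature.Probability.RandomPlanarGeometry Literature.Probability.LatticeModels
open Summit.CriticalPhenomena.SAWScalingLimit.Theses.SAWThetaPercolation

namespace Summit.CriticalPhenomena.SAWScalingLimit.Cruxes.ThetaWindowLimit.Birth

/-! ### 0. The crux's inlined objects, verbatim -/

/-- The contact-fugacity law `𝔓_{x,ω}` on SAWs of `Ω_δ ⊆ δℍ` from `a` to `b` (verbatim the
`let isawLaw` of the crux): `γ ↦ x^{V(γ)} ω^{K(γ)}`, `K = V − N`, normalised. -/
def isawLaw (Ω : Set ℂ) (δ x ω : ℝ) (a b : HexVertex) : Measure (SAW.HexDomainSAW Ω δ a b) :=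
  let w : Measure (SAW.HexDomainSAW Ω δ a b) :=
    Measure.sum (fun γ : SAW.HexDomainSAW Ω δ a b =>
      ENNReal.ofReal (x ^ γ.vertexCount * ω ^ (γ.vertexCount -
        (γ.walk.darts.toFinset.biUnion
          (fun d => hexFaceVertices d.fst ∩ hexFaceVertices d.snd)).card)) • Measure.dirac γ)
  (w Set.univ)⁻¹ • w

/-- The pinch/wall-free event `E_ε` (verbatim the `let good` of the crux). -/
def goodSet (ε : ℝ) (D : DobrushinDomain) : Set (CurveClass ℂ) :=
  {c | (∀ γ : Curve ℂ, CurveClass.mk γ = c → ∀ s t : unitInterval, s < t → γ s = γ t →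
      Metric.diam (γ '' Set.Icc s t) < ε) ∧
    c.range ∩ frontier D.carrier ⊆ Metric.ball (D.pt 0) ε ∪ Metric.ball (D.pt 1) ε}

/-- Conditioning (verbatim the `let cond` of the crux): `μ( · | S) = (μ S)⁻¹ • μ|_S`. -/
def cond (μ : Measure (CurveClass ℂ)) (S : Set (CurveClass ℂ)) : Measure (CurveClass ℂ) :=
  (μ S)⁻¹ • μ.restrict S

/-! ### 1. Statements of the stubs -/

/-- **Stub 1 — positivity of the pinch/wall-free event under SLE₆.** For every Dobrushin domain
`D`, every chordal SLE₆ law `μ` on `D` and every `ε > 0`, `μ (E_ε) ≠ 0`. -/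
def PinchEventPos : Prop :=
  ∀ (D : DobrushinDomain) (μ : Measure (CurveClass ℂ)), IsSLELaw 6 D μ →
    ∀ ε : ℝ, 0 < ε → μ (goodSet ε D) ≠ 0

/-- **Stub 2 — the pinch-free limit of SLE₆ exists.** For every Dobrushin domain `D` and every
chordal SLE₆ law `μ` on `D` charging every `E_ε`, the conditioned laws `μ( · | E_ε)` converge in law
(bounded continuous test functions, `ε → 0⁺`) to some probability measure `Λ` on `CurveClass ℂ`. -/
def PinchFreeLimit : Prop :=
  ∀ (D : DobrushinDomain) (μ : Measure (CurveClass ℂ)), IsSLELaw 6 D μ →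
    (∀ ε : ℝ, 0 < ε → μ (goodSet ε D) ≠ 0) →
    ∃ Λ : Measure (CurveClass ℂ), IsProbabilityMeasure Λ ∧
      TendstoLaw (Ωδ := fun _ => CurveClass ℂ) (fun _ c => c) (fun ε => cond μ (goodSet ε D)) id Λ

/-- **Stub 3 — the near-Θ′ window unpinches to the pinch-free limit.** There is ONE schedule
`ω(δ) → 2`, `ω(δ) < 2` eventually, `x(δ)`, such that for every Dobrushin domain `D`, every chordal
SLE₆ law `μ` on `D`, every probability measure `Λ` with `μ( · | E_ε) → Λ` in law as `ε → 0⁺`, and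
every hexagonal endpoint approximation `(a, b)` of `D`, the contact-fugacity interface laws
`𝔓_{x(δ),ω(δ)}` on `δℍ`, pushed to curves, converge in law to `Λ` as `δ → 0⁺`. -/
def UnpinchingWindow : Prop :=
  ∃ ωs xs : ℝ → ℝ, Tendsto ωs (𝓝[>] (0 : ℝ)) (𝓝 2) ∧ (∀ᶠ δ in 𝓝[>] (0 : ℝ), ωs δ < 2) ∧
    ∀ (D : DobrushinDomain) (μ Λ : Measure (CurveClass ℂ)), IsSLELaw 6 D μ →
      IsProbabilityMeasure Λ →
      TendstoLaw (Ωδ := fun _ => CurveClass ℂ) (fun _ c => c) (fun ε => cond μ (goodSet ε D)) id Λ →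
      ∀ (a b : ℝ → HexVertex), SAW.IsEmbEndpointApprox hexGraph hexCenter D a b →
        TendstoLaw (fun δ (γ : SAW.HexDomainSAW D.carrier δ (a δ) (b δ)) => γ.curve)
          (fun δ => isawLaw D.carrier δ (xs δ) (ωs δ) (a δ) (b δ)) id Λ

/-! ### 2. The registered stubs -/

/-- STUB 1 (SLE₆ support lemma; M-sized): positivity of the pinch/wall-free event. -/
theorem stub_pinchEventPos : PinchEventPos := by
  sorry

/-- STUB 2 (continuum, open): existence of the pinch-free `ε → 0⁺` limit of conditioned SLE₆. -/
theorem stub_pinchFreeLimit : PinchFreeLimit := by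
  sorry

/-- STUB 3 (lattice → continuum, open; the heart of the crux): the window laws converge to the
pinch-free limit. -/
theorem stub_unpinchingWindow : UnpinchingWindow := by
  sorry

namespace Registered

/-- Alias keyed by the registered stub name (the skeleton audit admits a hypothesis of the
composition iff its head constant is a registered obligation or is NAMED like a declared stub). -/
abbrev stub_pinchEventPos : Prop := PinchEventPos
/-- Alias keyed by the registered stub name. -/
abbrev stub_pinchFreeLimit : Prop := PinchFreeLimit
/-- Alias keyed by the registered stub name. -/
abbrev stub_unpinchingWindow : Prop := UnpinchingWindow

end Registered

/-! ### 3. Sorry-free glue -/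

/-- A chordal SLE₆ law exists in every Dobrushin domain (tree: Rohde–Schramm Cor. 3.5 is proved,
`RohdeSchramm2005_cor35_holds`; existence at `κ = 6 ≠ 8` is `exists_isSLECurve_at_of_cor35`). -/
theorem exists_isSLELaw_six (D : DobrushinDomain) : ∃ μ : Measure (CurveClass ℂ), IsSLELaw 6 D μ := by
  obtain ⟨Γ, hΓ⟩ := exists_isSLECurve_at_of_cor35 (κ := 6) (RohdeSchramm2005_cor35_holds _)
    (by norm_num) (by norm_num) D
  exact ⟨_, hΓ.isSLELaw_map⟩

/-! ### 4. The composition: the three stubs imply the crux BY NAME -/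

/-- **Skeleton theorem.** `PinchEventPos → PinchFreeLimit → UnpinchingWindow → ThetaWindowLimit`
(hypotheses under their registered stub names `Registered.stub_…`, reducible aliases):
choose an SLE₆ law `μ_D` in every Dobrushin domain (`exists_isSLELaw_six`), let `P D` be the
pinch-free limit of `μ_D` (stubs 1–2, `Classical.choose`), so that part (i) of the crux holds by
construction; part (ii) is stub 3 read at `Λ := P D`. -/
theorem ThetaWindowLimit_of (h1 : Registered.stub_pinchEventPos) (h2 : Registered.stub_pinchFreeLimit)
    (h3 : Registered.stub_unpinchingWindow) :
    Summit.CriticalPhenomena.SAWScalingLimit.Theses.SAWThetaPercolation.ThetaWindowLimit := by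
  choose μ hμ using exists_isSLELaw_six
  have hlim : ∀ D : DobrushinDomain, ∃ Λ : Measure (CurveClass ℂ), IsProbabilityMeasure Λ ∧
      TendstoLaw (Ωδ := fun _ => CurveClass ℂ) (fun _ c => c)
        (fun ε => cond (μ D) (goodSet ε D)) id Λ :=
    fun D => h2 D (μ D) (hμ D) (h1 D (μ D) (hμ D))
  choose Λ hΛprob hΛlim using hlim
  obtain ⟨ωs, xs, hω, hlt, hwin⟩ := h3
  unfold Summit.CriticalPhenomena.SAWScalingLimit.Theses.SAWThetaPercolation.ThetaWindowLimit
  dsimp only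
  refine ⟨Λ, fun D => ⟨μ D, hμ D, hΛlim D⟩, ωs, xs, hω, hlt, fun D a b hab => ?_⟩
  exact hwin D (μ D) (Λ D) (hμ D) (hΛprob D) (hΛlim D) a b hab

/-- Wiring check: the registered stubs feed `ThetaWindowLimit_of` as stated. -/
example : Summit.CriticalPhenomena.SAWScalingLimit.Theses.SAWThetaPercolation.ThetaWindowLimit :=
  ThetaWindowLimit_of stub_pinchEventPos stub_pinchFreeLimit stub_unpinchingWindow

end Summit.CriticalPhenomena.SAWScalingLimit.Cruxes.ThetaWindowLimit.Birth

end
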